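import Summits.QuantumFields.YangMills.Theorems.BalabanUVNodesN15SmallFieldSiteLayerLive
import Summits.QuantumFields.YangMills.Theorems.BalabanUVNodesN15ColouredFluctuationCovarianceRate
import HarnessLib

/-!
# N15 = NE2 — Σ-col (L-4): ★★★ THE UNIT LAYER OF dag-n15-c's LIVE SMALL-FIELD FAMILY READS THE NON-ABELIAN POTENTIAL — `NE2PlusUnit` BY NAME for the coloured (2.156) covariance
# `C_ι(C_ιᵀ(Δ^{(n)}⊗1 + exDress a (Δ^{(n)}⊗1) Z(A′))C_ι)⁻¹C_ιᵀ` built on the SAME dressed effective form as the site layer (J-c), on the large-cube sub-family of `sfInstance`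
# (dag-n15-a g29, programme Σ-col, FILE (L-4); node N15 = NE2; `--supports stmt-QuantumFields-27366 --as helper`, count-neutral; two plumbing `def`s + theorems)

WHY.  After (J-c)∕(J-d) the UNIT layer was the one U-blind layer left on dag-n15-c's carrier (FLAG №13's located burden, road (c)).  The unit object of [B9] Thm 3.15 ((3.185)–(3.187)) is the
(2.156) fluctuation covariance of the dressed effective form; with colour it is (L-1) `covC` at `Δ^{(n)}⊗1 + P(A′)`, `P(A′) = exDress a (Δ^{(n)}⊗1) Z(A′)` — the SAME exact dressing as the
site layer ((J-c′) `siteC − a·1`).  Its η-rate is (L-3) `covC_rate_king` fed with Σ-col (H)'s three letters of `P` ((J-b′) `exists_zLive_letters` → (H) (i)(ii)(iii)).  Since dag-n15-c's glued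
propagator is a genuine inverse only for cubes `L^m ≥ w₀` (FILE 133) and `NE2PlusUnit`'s quantifier shape has no size threshold, the statement is made on the SUB-FAMILY of large cubes
`SfIdxGE d L w` (jointly cofinal, so the K3⁸ guard still holds — (L-5)).

WHAT.  §1 `SfIdxGE d L w := {i : SfIdx d L // w ≤ L^{i.m}}`; def `foCovSf` (the U-live unit kernel on `sfInstance`, every index: fine `covC(Δ^{(L^rL^k)}⊗1 + P′(A′))` minus coarse
`covC(Δ^{(L^k)}⊗1 + P(A′))` at the coloured unit bonds `((ȳ,α),j)`, `((ȳ′,β),j′)`); `foCovSf_ker`; ★ `foCovSf_one` (CONSISTENCY: at the zero potential the kernel is b06's `(cov^{(L^rL^k)} − cov^{(L^k)}) ⊗ₖ 1_ι` — the live and the U-blind (S-D, (2.156) re-based) unit objects agree at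
`U ≡ 1`); `deltaCol_add_exDress_eq_siteC_sub` (the dressed form IS `siteC − a·1`, the site object of (J-c)).
§2 ★★★ **`ne2PlusUnit_foCovSf`**: `d ≥ 1`, odd `L ≥ 7`, `a, c₃₅ > 0`, trace-form-orthonormal `e`, `ι` nonempty ⟹ `∃ w, NE2PlusUnit c₃₅ (sfInstance ∘ val) (foCovSf ∘ val) ⊤ dist` on `SfIdxGE d L w`
— constants `(δ₀, a₀, B₀, θ) = (δ″, a₀(e), C′(1 + K(2K_Z + 1)) + 1, L^{−1∕16})`; the guard `L^m·α₀ ≤ a₀` carries FILE 133's smallness of `r_A = c₃₅L^mα₀`, (H)'s Combes–Thomas margin and (L-2)'s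
(2.153) margin `Kζ ≤ epsCovC`; (3.36) idle (said).

HONEST FRAMING ∕ LIMITS.  MODEL objects exactly as n15-c FILE 130∕133 and (L-1)…(L-3) (GENUINE: b06's p.250 elimination, (2.153) on the torus, the (1.66) matrix, the (1.102)–(1.103)
dressing; finite Combes–Thomas constants crude and ours) — NOT [B9] Thm 3.15 AS PRINTED (whose `γ′₀` at general `U` is asserted, G-B9-09); large-cube sub-family only.  N15 stays DISCHARGED
OF RECORD AS CONSUMED (U-blind v7 pin, p687738); no re-pin asked; no count moved; K3⁸ OPEN; one finite 𝕋⁴ at fixed ε per index — NOT ℝ⁴ ∕ OS ∕ mass gap ∕ Clay.  No `sorry`; standard axioms.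
[cite: Balaban1985BackgroundPropagators, Thm 3.15 (3.185)–(3.187) p.432 (quantifier template, shape), (3.35) p.396; Balaban1984PropagatorsII, (2.152)–(2.157) pp.249–250; Balaban1984PropagatorsI, (1.66) p.29, (1.102)–(1.103) p.34; King1986, Lemma 4.5 (4.38)–(4.41) pp.674–675 (shape, mechanism); CombesThomas1973, §II (mechanism)]
-/

noncomputable section

open scoped BigOperators Matrix Matrix.Norms.Frobenius Kronecker

namespace Summit.QuantumFields.YangMills.BalabanUVNodes.N15.SiteLayerSf

open Literature.MathematicalPhysics.QuantumFieldTheory.Balaban1983to89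
open Literature.MathematicalPhysics.QuantumFieldTheory.King1986 (exp_decay_mono)
open Literature.MathematicalPhysics.QuantumFieldTheory.Balaban1983to89.T4EtaRate (PairedInstance NE2PlusUnit EtaRateIneqUnit)
open Literature.MathematicalPhysics.QuantumFieldTheory.Balaban1983to89.B5Prop11Plancherel (Tor fine)
open Literature.MathematicalPhysics.QuantumFieldTheory.Balaban1983to89.B6Lemma24Torus (pbox)
open Literature.MathematicalPhysics.QuantumFieldTheory.Balaban1983to89.B6BondEliminationTorus (pdist)
open Literature.MathematicalPhysics.QuantumFieldTheory.Balaban1983to89.B6Cov2156Torus (deltaPol one_le_M bondReductionT)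
open Literature.MathematicalPhysics.QuantumFieldTheory.Balaban1983to89.T4Cov2156Rate (isUnit_sandwich_torus)
open Literature.MathematicalPhysics.QuantumFieldTheory.Balaban1983to89.B6LowerBound2153Torus (rep rep_mem_pbox)
open Literature.MathematicalPhysics.QuantumFieldTheory.Balaban1983to89.B6UnitTorusCarrier (unitTorusGeo pdist_rep_rep)
open Literature.MathematicalPhysics.QuantumFieldTheory.King1986.Torus (tdistT tdistT_nonneg)
open Literature.Barriers.QuantumFields (traceForm)
open Summit.QuantumFields.YangMills.BalabanUVNodes.N15.OperatorReadout (opGeo)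
open Summit.QuantumFields.YangMills.BalabanUVNodes.N15.VectorPiece (bshiftEquiv kingPrV tensorId unitTorusGeoS)
open Summit.QuantumFields.YangMills.BalabanUVNodes.N15.MatrixSpecies (basisConst basisConst_nonneg liftBlk)
open Summit.QuantumFields.YangMills.BalabanUVNodes.N15.UnitLayerBg (exDress exDress_zero)
open Summit.QuantumFields.YangMills.BalabanUVNodes.N15.UnitLayerBgCol (cdist cdist_eq cdist_nonneg siteC covC covC_kron_one covC_rate_king epsCovC epsCovC_pos exDress_deltaCol_letters
  kron_one_apply isUnit_det_smul_one_add_deltaCol)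
open Summit.QuantumFields.YangMills.BalabanUVNodes.N15.Gluing (SfIdx sfGeo sfInstance sfInstance_reg335_iff sfInstance_gf_M CvX CvX' cvM cvBlk)
open Summit.QuantumFields.YangMills.BalabanUVNodes.N15.GluedZeroField (zLiveC zLiveF exists_zLive_letters exists_zLive_zero)

variable (d : ℕ) {L : ℕ} [NeZero L] (mm ι : Type) [Fintype mm] [DecidableEq mm] [Fintype ι] [DecidableEq ι] (a : ℝ) (e : Matrix mm mm ℂ ≃L[ℝ] (ι → ℝ))

/-! ## §1 The large-cube sub-index and the U-live unit kernel -/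

section Kernel

/-- THE LARGE-CUBE SUB-INDEX of dag-n15-c's small-field family: cube size `L^m ≥ w` (FILE 133's gluing regime). [bookkeeping] -/
abbrev SfIdxGE (d L : ℕ) (w : ℝ) : Type := {i : SfIdx d L // w ≤ ((L ^ i.m : ℕ) : ℝ)}

omit [NeZero L] in
/-- For EVERY real `w` the large-cube sub-index is NONEMPTY — indeed jointly cofinal in `(L^m, kk)` ((L-5) `live_sfGE`): `SfIdx d L` carries cubes `L^m` with `m` unbounded and `L > 1`.  So no
witness `w` of §2's `∃ w, NE2PlusUnit …` makes the family empty (no vacuity): `w` is FILE 133's gluing threshold and the family above it is infinite. [folklore] -/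
theorem sfIdxGE_nonempty (hL : 1 < L) (w : ℝ) : Nonempty (SfIdxGE d L w) := by
  obtain ⟨m, hm⟩ := pow_unbounded_of_one_lt w (by exact_mod_cast hL : (1 : ℝ) < (L : ℝ))
  exact ⟨⟨⟨m, 1, 0, le_rfl⟩, by push_cast; exact hm.le⟩⟩

/-- ★ **THE U-LIVE UNIT-LAYER η-DIFFERENCE KERNEL ON dag-n15-c's SMALL-FIELD FAMILY**: on `sfInstance d mm ι hL i`, `(A′, y, y′) ↦ C′(A′)(((ȳ,α),j),((ȳ′,β),j′)) − C(A′)(…)` — the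
coloured (2.156) fluctuation covariance (L-1 `covC`) of the fine run's dressed effective form `Δ^{(L^rL^k)}⊗1 + exDress a (Δ^{(L^rL^k)}⊗1) (zLiveF … A′)` minus the coarse run's at
`Δ^{(L^k)}⊗1 + exDress a (Δ^{(L^k)}⊗1) (zLiveC … A′)` (coarse partner = the block-mean field, inside `zLiveC`), read at the coloured unit bonds of directions `α, β` and colours `j, j′`.
[cite: Balaban1985BackgroundPropagators, Thm 3.15 (3.185)–(3.187) p.432 (object `C^{(k)}_Λ(U)`, shape); Balaban1984PropagatorsII, (2.156) p.250] -/
def foCovSf (hL : Odd L ∧ 1 < L) (α β : Fin (d + 1)) (j j' : ι) (i : SfIdx d L) : B9.SiteKernel (sfInstance d mm ι hL i).gc (sfInstance d mm ι hL i).Bf :=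
  ⟨fun A' y y' =>
    covC L (cvM d L i.m i.kk hL) ι (deltaPol (cvM d L i.m i.kk hL) (L ^ i.r * L ^ i.kk) ⊗ₖ (1 : Matrix ι ι ℝ) +
        exDress a (deltaPol (cvM d L i.m i.kk hL) (L ^ i.r * L ^ i.kk) ⊗ₖ (1 : Matrix ι ι ℝ)) (zLiveF d mm ι a e hL i.m i.kk i.r A'))
        ((⟨rep (cvM d L i.m i.kk hL) y, rep_mem_pbox (cvM d L i.m i.kk hL) y⟩, α), j) ((⟨rep (cvM d L i.m i.kk hL) y', rep_mem_pbox (cvM d L i.m i.kk hL) y'⟩, β), j')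
      - covC L (cvM d L i.m i.kk hL) ι (deltaPol (cvM d L i.m i.kk hL) (L ^ i.kk) ⊗ₖ (1 : Matrix ι ι ℝ) +
        exDress a (deltaPol (cvM d L i.m i.kk hL) (L ^ i.kk) ⊗ₖ (1 : Matrix ι ι ℝ)) (zLiveC d mm ι a e hL i.m i.kk i.r A'))
        ((⟨rep (cvM d L i.m i.kk hL) y, rep_mem_pbox (cvM d L i.m i.kk hL) y⟩, α), j) ((⟨rep (cvM d L i.m i.kk hL) y', rep_mem_pbox (cvM d L i.m i.kk hL) y'⟩, β), j')⟩

/-- Unfolding of `foCovSf`. [folklore] -/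
theorem foCovSf_ker (hL : Odd L ∧ 1 < L) (α β : Fin (d + 1)) (j j' : ι) (i : SfIdx d L) (A' : Fin (d + 1) → CvX' d L i.m i.kk i.r hL → Matrix mm mm ℂ)
    (y y' : Tor (cvM d L i.m i.kk hL)) :
    (foCovSf d mm ι a e hL α β j j' i).ker A' y y' =
      covC L (cvM d L i.m i.kk hL) ι (deltaPol (cvM d L i.m i.kk hL) (L ^ i.r * L ^ i.kk) ⊗ₖ (1 : Matrix ι ι ℝ) +
          exDress a (deltaPol (cvM d L i.m i.kk hL) (L ^ i.r * L ^ i.kk) ⊗ₖ (1 : Matrix ι ι ℝ)) (zLiveF d mm ι a e hL i.m i.kk i.r A'))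
          ((⟨rep (cvM d L i.m i.kk hL) y, rep_mem_pbox (cvM d L i.m i.kk hL) y⟩, α), j) ((⟨rep (cvM d L i.m i.kk hL) y', rep_mem_pbox (cvM d L i.m i.kk hL) y'⟩, β), j')
        - covC L (cvM d L i.m i.kk hL) ι (deltaPol (cvM d L i.m i.kk hL) (L ^ i.kk) ⊗ₖ (1 : Matrix ι ι ℝ) +
          exDress a (deltaPol (cvM d L i.m i.kk hL) (L ^ i.kk) ⊗ₖ (1 : Matrix ι ι ℝ)) (zLiveC d mm ι a e hL i.m i.kk i.r A'))
          ((⟨rep (cvM d L i.m i.kk hL) y, rep_mem_pbox (cvM d L i.m i.kk hL) y⟩, α), j) ((⟨rep (cvM d L i.m i.kk hL) y', rep_mem_pbox (cvM d L i.m i.kk hL) y'⟩, β), j') := rfl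

/-- ★ **CONSISTENCY — AT THE ZERO POTENTIAL THE U-LIVE UNIT KERNEL IS b06's (2.156) COVARIANCE η-DIFFERENCE ⊗ 1_ι** (`d ≥ 1`, `L ≥ 7` odd, `a > 0`, indices with `L^m ≥ w₀`,
trace-form-orthonormal `e`): at the carrier's `one` (the zero potential) both live background matrices vanish ((J-b′) `exists_zLive_zero`), both exact dressings vanish (V-A `exDress_zero`),
and `covC (Δ^{(n)} ⊗ₖ 1) = (bondReductionT L M Δ^{(n)}).cov ⊗ₖ 1` ((L-1) `covC_kron_one`, (2.157) `isUnit_sandwich_torus`) — the kernel is `[j = j′]·(cov^{(L^rL^k)} − cov^{(L^k)})` at the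
King-block representatives (= part 76's `covDiff` ∕ S-D's `covOnS` kernel of record, times `δ_{jj′}`): the live and the U-blind ((2.156) re-based, S-D) unit objects AGREE at `U ≡ 1`. [cite: Balaban1984PropagatorsII, (2.156)–(2.157) p.250; Balaban1984PropagatorsI, (1.71) p.30] -/
theorem foCovSf_one (hd : 1 ≤ d) (hL : Odd L ∧ 1 < L) (hL7 : 7 ≤ L) (ha : 0 < a) (α β : Fin (d + 1)) (j j' : ι) :
    ∃ w₀ : ℝ, ∀ (i : SfIdx d L), w₀ ≤ ((L ^ i.m : ℕ) : ℝ) → (∀ A B : Matrix mm mm ℂ, traceForm A B = e A ⬝ᵥ e B) → ∀ (y y' : Tor (cvM d L i.m i.kk hL)),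
      (foCovSf d mm ι a e hL α β j j' i).ker (sfInstance d mm ι hL i).Bf.one y y' =
        if j = j' then
          (bondReductionT L (cvM d L i.m i.kk hL) (deltaPol (cvM d L i.m i.kk hL) (L ^ i.r * L ^ i.kk))).cov
              ((⟨rep (cvM d L i.m i.kk hL) y, rep_mem_pbox (cvM d L i.m i.kk hL) y⟩, α) : B4.Idx (pbox (cvM d L i.m i.kk hL)) (d + 1))
              ((⟨rep (cvM d L i.m i.kk hL) y', rep_mem_pbox (cvM d L i.m i.kk hL) y'⟩, β) : B4.Idx (pbox (cvM d L i.m i.kk hL)) (d + 1)) -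
            (bondReductionT L (cvM d L i.m i.kk hL) (deltaPol (cvM d L i.m i.kk hL) (L ^ i.kk))).cov
              ((⟨rep (cvM d L i.m i.kk hL) y, rep_mem_pbox (cvM d L i.m i.kk hL) y⟩, α) : B4.Idx (pbox (cvM d L i.m i.kk hL)) (d + 1))
              ((⟨rep (cvM d L i.m i.kk hL) y', rep_mem_pbox (cvM d L i.m i.kk hL) y'⟩, β) : B4.Idx (pbox (cvM d L i.m i.kk hL)) (d + 1))
        else 0 := by
  obtain ⟨w₀, H⟩ := exists_zLive_zero d mm ι a e hL hL7 ha
  refine ⟨w₀, fun i hw he y y' => ?_⟩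
  have hLpos : 0 < L := Nat.pos_of_ne_zero (NeZero.ne L)
  have hLk : 1 ≤ L ^ i.kk := Nat.one_le_pow _ _ hLpos
  have hLrk : 1 ≤ L ^ i.r * L ^ i.kk := Nat.one_le_iff_ne_zero.mpr (Nat.mul_ne_zero (pow_ne_zero _ hLpos.ne') (pow_ne_zero _ hLpos.ne'))
  have hLMdvd : ∀ μ, L ∣ cvM d L i.m i.kk hL μ := fun μ => by
    show L ∣ 2 * L ^ (i.m + 1)
    exact Dvd.dvd.mul_left (dvd_pow_self L (Nat.succ_ne_zero _)) 2
  have hd2 : 2 ≤ d + 1 := by omega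
  obtain ⟨hZc, hZf⟩ := H i.m i.kk i.r i.one_le hw he
  have h1 : (sfInstance d mm ι hL i).Bf.one = (0 : Fin (d + 1) → CvX' d L i.m i.kk i.r hL → Matrix mm mm ℂ) := rfl
  haveI : NeZero (L ^ i.kk) := ⟨by omega⟩
  haveI : NeZero (L ^ i.r * L ^ i.kk) := ⟨by omega⟩
  rw [h1, foCovSf_ker, hZc, hZf, exDress_zero (isUnit_det_smul_one_add_deltaCol _ ι _ a hLrk ha), exDress_zero (isUnit_det_smul_one_add_deltaCol _ ι _ a hLk ha), add_zero, add_zero,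
    covC_kron_one (isUnit_sandwich_torus hd2 hLpos hLMdvd hLrk), covC_kron_one (isUnit_sandwich_torus hd2 hLpos hLMdvd hLk), kron_one_apply, kron_one_apply]
  by_cases hj : j = j' <;> simp [hj]

variable {d mm ι a e} in
omit [NeZero L] [Fintype mm] [DecidableEq mm] in
/-- THE DRESSED FORM IS THE SITE OBJECT MINUS `a·1`: `Δ^{(n)}⊗1 + exDress a (Δ^{(n)}⊗1) Z = siteC M ι n a Z − a·1` — the unit kernel is built on the SAME dressed effective form as the site
layer of (J-c). [cite: Balaban1984PropagatorsI, (1.65) p.29, (1.102)–(1.103) p.34] -/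
theorem deltaCol_add_exDress_eq_siteC_sub (M : Fin (d + 1) → ℕ) [∀ μ, NeZero (M μ)] (n : ℕ) (Z : Matrix (B4.Idx (pbox M) (d + 1) × ι) (B4.Idx (pbox M) (d + 1) × ι) ℝ) :
    deltaPol M n ⊗ₖ (1 : Matrix ι ι ℝ) + exDress a (deltaPol M n ⊗ₖ (1 : Matrix ι ι ℝ)) Z =
      siteC M ι n a Z - a • (1 : Matrix (B4.Idx (pbox M) (d + 1) × ι) (B4.Idx (pbox M) (d + 1) × ι) ℝ) := by
  rw [siteC]; abel

end Kernel

/-! ## §2 ★★★ `NE2PlusUnit` by name, background live through the exact dressing with colour, on the large-cube sub-family -/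

section UnitLayer

set_option maxHeartbeats 800000 in
/-- ★★★ **`NE2PlusUnit` — THE NODE's THIRD CONJUNCT BY NAME — FOR THE U-LIVE COLOURED (2.156) COVARIANCE ON dag-n15-c's LIVE SMALL-FIELD FAMILY (large-cube sub-family).**  For `d ≥ 1`,
odd `L ≥ 7`, `a > 0`, `c₃₅ > 0`, a trace-form-orthonormal `e` (`ι` nonempty), directions `α β` and colours `j j′`: there is `w` (FILE 133's cube threshold, after `d, L, a, ι`) with
`NE2PlusUnit c₃₅ (fun i : SfIdxGE d L w => sfInstance d mm ι hL i.1) (fun i => foCovSf d mm ι a e hL α β j j′ i.1) ⊤ dist` — constants `(δ₀, a₀, B₀, θ = L^{−1∕16})`; the kernel READS `A′`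
through both live background matrices; chain (J-b′) `exists_zLive_letters` → (H) `exDress_deltaCol_letters` (i)(ii)(iii) → (L-3) `covC_rate_king`; thresholds: FILE 145's `a_W, a_R`, the
Combes–Thomas margin `a_ζ`, `a_1`, and (L-2)'s (2.153) margin `a_ε` (`KK_Zκ_e r_A ≤ epsCovC`); (3.36) idle (said). VACUITY: `SfIdxGE d L w` is nonempty — indeed cofinal — for EVERY `w` (`sfIdxGE_nonempty`, (L-5) `live_sfGE`); the witness `w` IS FILE 133's
gluing threshold `w₀` and the constants `(δ₀, a₀, B₀)` are chosen together with it from `(d, L, a, e, |ι|, c₃₅)` — none varies with the index.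
[cite: Balaban1985BackgroundPropagators, Thm 3.15 (3.185)–(3.187) p.432
(quantifier template, shape), (3.35) p.396; Balaban1984PropagatorsII, (2.153)–(2.157) pp.249–250; King1986, Lemma 4.5 (4.38)–(4.41) pp.674–675 (shape, mechanism); CombesThomas1973, §II (mechanism)] -/
theorem ne2PlusUnit_foCovSf [Nonempty ι] (hd : 1 ≤ d) (hL : Odd L ∧ 1 < L) (hL7 : 7 ≤ L) (ha : 0 < a) {c35 : ℝ} (hc35 : 0 < c35)
    (he : ∀ A B : Matrix mm mm ℂ, traceForm A B = e A ⬝ᵥ e B) (α β : Fin (d + 1)) (j j' : ι) :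
    ∃ w : ℝ, NE2PlusUnit c35 (fun i : SfIdxGE d L w => sfInstance d mm ι hL i.1) (fun i => foCovSf d mm ι a e hL α β j j' i.1) (fun _ _ => True)
      (fun i => (sfInstance d mm ι hL i.1).gc.dist) := by
  have hLpos : 0 < L := Nat.pos_of_ne_zero (NeZero.ne L)
  have hL1 : 1 ≤ L := hLpos
  have hLr : (0 : ℝ) < (L : ℝ) := Nat.cast_pos.mpr hLpos
  have hL1r : (1 : ℝ) ≤ (L : ℝ) := by exact_mod_cast hLpos
  have hL2 : 2 ≤ L := by omega
  -- the three constant packages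
  obtain ⟨δz, w₀, R₀, Kz, hδz, hR₀, hKz, HZ⟩ := exists_zLive_letters d mm ι a e hL hL7 ha
  obtain ⟨K, δ', ζ₀, hK, hδ', hζ₀, HP⟩ := exDress_deltaCol_letters d (Fintype.card ι) ha hδz
  obtain ⟨C', δ'', hC', hδ'', HC⟩ := covC_rate_king L hd hL1 (Fintype.card ι) hδ'
  have hε₀ := epsCovC_pos (d := d) L hL1 (Fintype.card ι) hδ'
  -- the thresholds
  have hκ0 : 0 ≤ basisConst e := basisConst_nonneg e
  let σ : ℝ := 14 * Real.exp 1 * (1 + Fintype.card (Fin (d + 1))) * basisConst e * ((1 + Fintype.card (Fin (d + 1))) * (3 + 2 * ((d : ℝ) + 1)))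
  have hσ0 : 0 ≤ σ := by positivity
  let JJ : ℝ := 1 + Fintype.card (Fin (d + 1) ⊕ Fin (d + 1))
  have hJJ0 : 0 ≤ JJ := by positivity
  let W : ℝ := 2 * ((1 + Fintype.card (Fin (d + 1))) * (3 + 2 * ((d : ℝ) + 1)))
  have hW0 : 0 < W := by positivity
  let aW : ℝ := 1 / (W * c35)
  have haW : 0 < aW := by positivity
  let aR : ℝ := R₀ / (σ * c35 * JJ + 1)
  have haR : 0 < aR := by positivity
  let aζ : ℝ := ζ₀ / (Kz * (basisConst e + 1) * c35)
  have haζ : 0 < aζ := by positivity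
  let a1 : ℝ := 1 / ((basisConst e + 1) * c35)
  have ha1 : 0 < a1 := by positivity
  let aε : ℝ := epsCovC d L (Fintype.card ι) δ' / (K * Kz * (basisConst e + 1) * c35)
  have haε : 0 < aε := by positivity
  let a₀ : ℝ := min (min aW aR) (min (min aζ a1) aε)
  have ha₀ : 0 < a₀ := lt_min (lt_min haW haR) (lt_min (lt_min haζ ha1) haε)
  have ha₀W : a₀ ≤ aW := (min_le_left _ _).trans (min_le_left _ _)
  have ha₀R : a₀ ≤ aR := (min_le_left _ _).trans (min_le_right _ _)
  have ha₀ζ : a₀ ≤ aζ := (min_le_right _ _).trans ((min_le_left _ _).trans (min_le_left _ _))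
  have ha₀1 : a₀ ≤ a1 := (min_le_right _ _).trans ((min_le_left _ _).trans (min_le_right _ _))
  have ha₀ε : a₀ ≤ aε := (min_le_right _ _).trans (min_le_right _ _)
  refine ⟨max w₀ 1, δ'', a₀, C' * (1 + K * (2 * Kz + 1)) + 1, (L : ℝ) ^ (-(1 / 16 : ℝ)), hδ'', ha₀, by positivity, Real.rpow_pos_of_pos hLr _,
    Real.rpow_lt_one_of_one_lt_of_neg (by exact_mod_cast hL2) (by norm_num), fun i α₀ hα₀ hMa A' hA' _ y y' _ _ => ?_⟩
  -- the index's scalar facts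
  have hM : max w₀ 1 ≤ ((L ^ i.1.m : ℕ) : ℝ) := i.2
  rw [sfInstance_gf_M] at hMa
  have hw₀ : w₀ ≤ ((L ^ i.1.m : ℕ) : ℝ) := (le_max_left _ _).trans hM
  have hx1 : (1 : ℝ) ≤ (L : ℝ) ^ i.1.kk := one_le_pow₀ hL1r
  have hxpos : (0 : ℝ) < (L : ℝ) ^ i.1.kk := pow_pos hLr _
  have hcast : (((L ^ i.1.kk : ℕ) : ℝ)) = (L : ℝ) ^ i.1.kk := by push_cast; rfl
  have hLMdvd : ∀ μ, L ∣ cvM d L i.1.m i.1.kk hL μ := fun μ => by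
    show L ∣ 2 * L ^ (i.1.m + 1)
    exact Dvd.dvd.mul_left (dvd_pow_self L (Nat.succ_ne_zero _)) 2
  set t : ℝ := ((L : ℝ) ^ i.1.kk) ^ (-(1 / 16 : ℝ)) with ht_def
  have ht0 : 0 ≤ t := Real.rpow_nonneg hxpos.le _
  have hθt : (((L ^ i.1.kk : ℕ) : ℝ)) ^ (-(1 / 16 : ℝ)) = t := by rw [hcast]
  have hinv : ((((L ^ i.1.kk : ℕ) : ℝ)))⁻¹ ≤ t := by
    rw [hcast, ← Real.rpow_neg_one]; exact Real.rpow_le_rpow_of_exponent_le hx1 (by norm_num)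
  have hinv' : ((L : ℝ) ^ i.1.kk)⁻¹ ≤ t := by rw [← hcast]; exact hinv
  have hη0 : 0 ≤ ((((L ^ i.1.kk : ℕ) : ℝ)))⁻¹ := by positivity
  -- the class at the index: skewness and the C² window at scale `r_A = c₃₅L^mα₀` (FILE 145's conversion)
  obtain ⟨hskew, h1, h2, h3⟩ := (sfInstance_reg335_iff d mm ι hL i.1 c35 α₀ A').1 hA'
  have hconv : ((L : ℝ) ^ i.1.kk)⁻¹ * ((L : ℝ) ^ i.1.r)⁻¹ = (((L ^ i.1.r * L ^ i.1.kk : ℕ) : ℝ))⁻¹ := by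
    push_cast
    rw [mul_inv, mul_comm]
  have hrA0 : 0 ≤ c35 * (L : ℝ) ^ i.1.m * α₀ := by positivity
  have hrAa : c35 * (L : ℝ) ^ i.1.m * α₀ ≤ c35 * a₀ := by
    rw [mul_assoc]; exact mul_le_mul_of_nonneg_left hMa hc35.le
  have h2' : ∀ μ κ x', ‖A' μ (bshiftEquiv (cvM d L i.1.m i.1.kk hL) (L ^ i.1.r * L ^ i.1.kk) κ x') - A' μ x'‖ ≤ c35 * (L : ℝ) ^ i.1.m * α₀ * ((((L ^ i.1.r * L ^ i.1.kk : ℕ) : ℝ))⁻¹) :=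
    fun μ κ x' => (h2 μ κ x').trans_eq (by rw [hconv])
  have h3' : ∀ μ κ x', ‖(A' μ (bshiftEquiv (cvM d L i.1.m i.1.kk hL) (L ^ i.1.r * L ^ i.1.kk) κ x') - A' μ x') -
      (A' μ (bshiftEquiv (cvM d L i.1.m i.1.kk hL) (L ^ i.1.r * L ^ i.1.kk) κ ((bshiftEquiv (cvM d L i.1.m i.1.kk hL) (L ^ i.1.r * L ^ i.1.kk) μ).symm x')) -
        A' μ ((bshiftEquiv (cvM d L i.1.m i.1.kk hL) (L ^ i.1.r * L ^ i.1.kk) μ).symm x'))‖ ≤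
      c35 * (L : ℝ) ^ i.1.m * α₀ * ((((L ^ i.1.r * L ^ i.1.kk : ℕ) : ℝ))⁻¹) * ((((L ^ i.1.r * L ^ i.1.kk : ℕ) : ℝ))⁻¹) :=
    fun μ κ x' => (h3 μ κ x').trans_eq (by rw [hconv])
  have hr2 : 2 * ((1 + Fintype.card (Fin (d + 1))) * ((3 + 2 * ((d : ℝ) + 1)) * (c35 * (L : ℝ) ^ i.1.m * α₀))) ≤ 1 := by
    have hWa : W * (c35 * a₀) ≤ 1 := by
      calc W * (c35 * a₀) ≤ W * (c35 * aW) := mul_le_mul_of_nonneg_left (mul_le_mul_of_nonneg_left ha₀W hc35.le) hW0.le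
        _ = 1 := by
          show W * (c35 * (1 / (W * c35))) = 1
          field_simp
    calc 2 * ((1 + Fintype.card (Fin (d + 1))) * ((3 + 2 * ((d : ℝ) + 1)) * (c35 * (L : ℝ) ^ i.1.m * α₀))) = W * (c35 * (L : ℝ) ^ i.1.m * α₀) := by ring
      _ ≤ W * (c35 * a₀) := mul_le_mul_of_nonneg_left hrAa hW0.le
      _ ≤ 1 := hWa
  have hscale : 14 * Real.exp 1 * (1 + Fintype.card (Fin (d + 1))) * basisConst e * ((1 + Fintype.card (Fin (d + 1))) * ((3 + 2 * ((d : ℝ) + 1)) * (c35 * (L : ℝ) ^ i.1.m * α₀))) =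
      σ * (c35 * (L : ℝ) ^ i.1.m * α₀) := by ring
  have hSle : σ * (c35 * (L : ℝ) ^ i.1.m * α₀) ≤ σ * (c35 * a₀) := mul_le_mul_of_nonneg_left hrAa hσ0
  have hRle : 14 * Real.exp 1 * (1 + Fintype.card (Fin (d + 1))) * basisConst e * ((1 + Fintype.card (Fin (d + 1))) * ((3 + 2 * ((d : ℝ) + 1)) * (c35 * (L : ℝ) ^ i.1.m * α₀))) *
      (1 + Fintype.card (Fin (d + 1) ⊕ Fin (d + 1))) ≤ R₀ := by
    rw [hscale]
    have hRa : σ * (c35 * aR) * JJ ≤ R₀ := by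
      have hden : 0 < σ * c35 * JJ + 1 := by positivity
      calc σ * (c35 * aR) * JJ = R₀ * (σ * c35 * JJ) / (σ * c35 * JJ + 1) := by
            show σ * (c35 * (R₀ / (σ * c35 * JJ + 1))) * JJ = R₀ * (σ * c35 * JJ) / (σ * c35 * JJ + 1)
            field_simp
        _ ≤ R₀ * (σ * c35 * JJ + 1) / (σ * c35 * JJ + 1) := by gcongr; linarith
        _ = R₀ := by field_simp
    calc σ * (c35 * (L : ℝ) ^ i.1.m * α₀) * JJ ≤ σ * (c35 * a₀) * JJ := mul_le_mul_of_nonneg_right hSle hJJ0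
      _ ≤ σ * (c35 * aR) * JJ := mul_le_mul_of_nonneg_right (mul_le_mul_of_nonneg_left (mul_le_mul_of_nonneg_left ha₀R hc35.le) hσ0) hJJ0
      _ ≤ R₀ := hRa
  -- the margins: `κ_e r_A ≤ 1`, `K_Z κ_e r_A ≤ ζ₀`, `K K_Z κ_e r_A ≤ epsCovC`
  have hκr1 : basisConst e * (c35 * (L : ℝ) ^ i.1.m * α₀) ≤ 1 := by
    calc basisConst e * (c35 * (L : ℝ) ^ i.1.m * α₀) ≤ (basisConst e + 1) * (c35 * a1) :=
          mul_le_mul (by linarith) (hrAa.trans (mul_le_mul_of_nonneg_left ha₀1 hc35.le)) hrA0 (by positivity)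
      _ = 1 := by
          show (basisConst e + 1) * (c35 * (1 / ((basisConst e + 1) * c35))) = 1
          field_simp
  have hζle : Kz * basisConst e * (c35 * (L : ℝ) ^ i.1.m * α₀) ≤ ζ₀ := by
    calc Kz * basisConst e * (c35 * (L : ℝ) ^ i.1.m * α₀) ≤ Kz * (basisConst e + 1) * (c35 * aζ) :=
          mul_le_mul (mul_le_mul_of_nonneg_left (by linarith) hKz.le) (hrAa.trans (mul_le_mul_of_nonneg_left ha₀ζ hc35.le)) hrA0 (by positivity)
      _ = ζ₀ := by
          show Kz * (basisConst e + 1) * (c35 * (ζ₀ / (Kz * (basisConst e + 1) * c35))) = ζ₀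
          field_simp
  have hεle : K * (Kz * basisConst e * (c35 * (L : ℝ) ^ i.1.m * α₀)) ≤ epsCovC d L (Fintype.card ι) δ' := by
    calc K * (Kz * basisConst e * (c35 * (L : ℝ) ^ i.1.m * α₀)) ≤ K * (Kz * (basisConst e + 1) * (c35 * aε)) :=
          mul_le_mul_of_nonneg_left (mul_le_mul (mul_le_mul_of_nonneg_left (by linarith) hKz.le) (hrAa.trans (mul_le_mul_of_nonneg_left ha₀ε hc35.le)) hrA0 (by positivity)) hK.le
      _ = epsCovC d L (Fintype.card ι) δ' := by
          show K * (Kz * (basisConst e + 1) * (c35 * (epsCovC d L (Fintype.card ι) δ' / (K * Kz * (basisConst e + 1) * c35)))) = epsCovC d L (Fintype.card ι) δ'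
          field_simp
  have hζ0 : 0 ≤ Kz * basisConst e * (c35 * (L : ℝ) ^ i.1.m * α₀) := by positivity
  have hτ0 : 0 ≤ Kz * ((((L ^ i.1.kk : ℕ) : ℝ)) ^ (-(1 / 16 : ℝ)) + basisConst e * (c35 * (L : ℝ) ^ i.1.m * α₀) * ((((L ^ i.1.kk : ℕ) : ℝ))⁻¹)) := by positivity
  -- (J-b′): the three letters of the live background matrices
  obtain ⟨hZ, hZ', hZZ⟩ := HZ i.1.m i.1.kk i.1.r i.1.one_le hw₀ he A' hskew (c35 * (L : ℝ) ^ i.1.m * α₀) hrA0 h1 h2' h3' hr2 hRle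
  have hLk : 1 ≤ L ^ i.1.kk := Nat.one_le_pow _ _ hLpos
  have hLrr : 1 ≤ L ^ i.1.r := Nat.one_le_pow _ _ hLpos
  -- (H): the three letters of the exact perturbation (rate `δ′`)
  obtain ⟨-, -, hP1, hP2, hP12⟩ := HP (cvM d L i.1.m i.1.kk hL) ι le_rfl (L ^ i.1.kk) (L ^ i.1.r * L ^ i.1.kk) (L ^ i.1.r) hLk hLrr rfl
    (zLiveC d mm ι a e hL i.1.m i.1.kk i.1.r A') (zLiveF d mm ι a e hL i.1.m i.1.kk i.1.r A') _ _ hζ0 hζle hτ0 hZ hZ' hZZ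
  have hKζ0 : 0 ≤ K * (Kz * basisConst e * (c35 * (L : ℝ) ^ i.1.m * α₀)) := by positivity
  have hKτ0 : 0 ≤ K * (Kz * ((((L ^ i.1.kk : ℕ) : ℝ)) ^ (-(1 / 16 : ℝ)) + basisConst e * (c35 * (L : ℝ) ^ i.1.m * α₀) * ((((L ^ i.1.kk : ℕ) : ℝ))⁻¹)) + ((L ^ i.1.kk : ℕ) : ℝ)⁻¹) := by
    positivity
  -- (L-3): the η-rate of the coloured covariance
  set M := cvM d L i.1.m i.1.kk hL with hMdef
  set pp : B4.Idx (pbox M) (d + 1) × ι := ((⟨rep M y, rep_mem_pbox M y⟩, α), j) with hpp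
  set qq : B4.Idx (pbox M) (d + 1) × ι := ((⟨rep M y', rep_mem_pbox M y'⟩, β), j') with hqq
  have hcov := HC M hLMdvd ι le_rfl i.1.kk i.1.r _ _ _ _ hKζ0 hεle hKτ0 hP1 hP2 hP12 pp qq
  have hcd : cdist M ι pp qq = tdistT M y y' := by
    rw [cdist_eq, hpp, hqq]
    exact pdist_rep_rep M (one_le_M M) y y'
  rw [hcd] at hcov
  -- the readout: unit distance, clean rate `θ^k = (L^k)^{−1/16}`
  show |(foCovSf d mm ι a e hL α β j j' i.1).ker A' y y'| ≤ (C' * (1 + K * (2 * Kz + 1)) + 1) * Real.exp (-(δ'' * tdistT M y y')) * ((L : ℝ) ^ (-(1 / 16 : ℝ))) ^ i.1.kk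
  have hrpow : ((L : ℝ) ^ i.1.kk) ^ (-(1 / 16 : ℝ)) = ((L : ℝ) ^ (-(1 / 16 : ℝ))) ^ i.1.kk := by
    -- `(L^k)^{−γ} = (L^{−γ})^k` (part 79 `UnitLayerBg.rpow_pow_eq`, inlined to keep the import list short)
    rw [← Real.rpow_natCast, ← Real.rpow_mul hLr.le, mul_comm, Real.rpow_mul hLr.le, Real.rpow_natCast]
  rw [foCovSf_ker, ← hrpow]
  refine hcov.trans ?_
  have hE := Real.exp_nonneg (-(δ'' * tdistT M y y'))
  -- the amplitude against `t`
  have hamp : C' * (((L : ℝ) ^ i.1.kk)⁻¹ + K * (Kz * ((((L ^ i.1.kk : ℕ) : ℝ)) ^ (-(1 / 16 : ℝ)) + basisConst e * (c35 * (L : ℝ) ^ i.1.m * α₀) * ((((L ^ i.1.kk : ℕ) : ℝ))⁻¹)) +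
      ((L ^ i.1.kk : ℕ) : ℝ)⁻¹)) ≤ (C' * (1 + K * (2 * Kz + 1)) + 1) * t := by
    rw [hθt]
    have h2 : basisConst e * (c35 * (L : ℝ) ^ i.1.m * α₀) * ((((L ^ i.1.kk : ℕ) : ℝ))⁻¹) ≤ t := by
      calc basisConst e * (c35 * (L : ℝ) ^ i.1.m * α₀) * ((((L ^ i.1.kk : ℕ) : ℝ))⁻¹) ≤ 1 * t := mul_le_mul hκr1 hinv hη0 zero_le_one
        _ = t := one_mul t
    have h4 : Kz * (t + basisConst e * (c35 * (L : ℝ) ^ i.1.m * α₀) * ((((L ^ i.1.kk : ℕ) : ℝ))⁻¹)) ≤ Kz * (t + t) :=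
      mul_le_mul_of_nonneg_left (add_le_add le_rfl h2) hKz.le
    have h5 : K * (Kz * (t + basisConst e * (c35 * (L : ℝ) ^ i.1.m * α₀) * ((((L ^ i.1.kk : ℕ) : ℝ))⁻¹)) + ((L ^ i.1.kk : ℕ) : ℝ)⁻¹) ≤ K * (2 * Kz + 1) * t := by
      calc K * (Kz * (t + basisConst e * (c35 * (L : ℝ) ^ i.1.m * α₀) * ((((L ^ i.1.kk : ℕ) : ℝ))⁻¹)) + ((L ^ i.1.kk : ℕ) : ℝ)⁻¹) ≤ K * (Kz * (t + t) + t) :=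
            mul_le_mul_of_nonneg_left (add_le_add h4 hinv) hK.le
        _ = K * (2 * Kz + 1) * t := by ring
    calc C' * (((L : ℝ) ^ i.1.kk)⁻¹ + K * (Kz * (t + basisConst e * (c35 * (L : ℝ) ^ i.1.m * α₀) * ((((L ^ i.1.kk : ℕ) : ℝ))⁻¹)) + ((L ^ i.1.kk : ℕ) : ℝ)⁻¹))
        ≤ C' * (t + K * (2 * Kz + 1) * t) := mul_le_mul_of_nonneg_left (add_le_add hinv' h5) hC'.le
      _ = (C' * (1 + K * (2 * Kz + 1))) * t := by ring
      _ ≤ (C' * (1 + K * (2 * Kz + 1)) + 1) * t := mul_le_mul_of_nonneg_right (by linarith) ht0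
  calc C' * (((L : ℝ) ^ i.1.kk)⁻¹ + K * (Kz * ((((L ^ i.1.kk : ℕ) : ℝ)) ^ (-(1 / 16 : ℝ)) + basisConst e * (c35 * (L : ℝ) ^ i.1.m * α₀) * ((((L ^ i.1.kk : ℕ) : ℝ))⁻¹)) +
        ((L ^ i.1.kk : ℕ) : ℝ)⁻¹)) * Real.exp (-(δ'' * tdistT M y y'))
      ≤ ((C' * (1 + K * (2 * Kz + 1)) + 1) * t) * Real.exp (-(δ'' * tdistT M y y')) := mul_le_mul_of_nonneg_right hamp hE
    _ = _ := by rw [ht_def]; ring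

end UnitLayer

end Summit.QuantumFields.YangMills.BalabanUVNodes.N15.SiteLayerSf

end
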